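import Literature.NumberTheory.Automorphic.HarrisLanTaylorThorneTwistedPairLimit
import Literature.NumberTheory.Automorphic.WeaklyRegularGaloisRepNormTwistProofs
import Literature.NumberTheory.Automorphic.PolarizedCompatibleSystemRationalModels
import Literature.NumberTheory.GaloisRepresentations.FramedRepBlockSum
import Literature.NumberTheory.GaloisRepresentations.FramedGaloisRepSemisimplification
import Literature.NumberTheory.GaloisRepresentations.TateTwistFrobeniusProofs
import Literature.RepresentationTheory.Semisimple.Semisimplification
import Literature.RepresentationTheory.Semisimple.Twist
import HarnessLib

/-!
# Harris–Lan–Taylor–Thorne 2016, Cor. 1.3: the printed proof, modulo its two inputs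

Topic `Literature/NumberTheory/Automorphic` (theorems only; no definition, no named fact).  Sibling
proofs file of `HarrisLanTaylorThorneTwistedPairLimit.lean`, for the named fact
`HarrisLanTaylorThorne2016_corollary13_cuspidalUnitary` (HLTT, Res. Math. Sci. 3:37, Cor. 1.3 for
cuspidal representations of the quasi-split unitary group in `2n` variables).

The printed proof of Cor. 1.3 (p. 31) is one sentence: "Combine the proposition [Prop. 1.2] with,
for instance, theorem 1.2 of [BLGHT] and theorem A of [BLGGT]."  Prop. 1.2 (p. 30, "[Shin] and
the classification of square integrable automorphic representations of `GL_m(𝔸_F)` [MW]") says: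
for `Π` square integrable on `G_n(𝔸)` with `Π_∞` cohomological there are `2n = Σ_i m_i n_i` and
cuspidal `Π̃_i` on `GL_{m_i}(𝔸_F)` with `Π̃_i^∨ ≅ Π̃_i^c`, `Π̃_i‖det‖^{(m_i+n_i-1)/2}`
cohomological, and `BC(Π_q)_v = ⊞_i ⊞_{j=0}^{n_i-1} Π̃_{i,v}|det|_v^{(n_i-1)/2-j}` at every prime
`v` of `F` above a rational `q` with `F` and `Π` unramified above `q` (or `q` split in `F₀`).
The two inputs are therefore

* (I1) Prop. 1.2 — Shin's cohomological base change, NOT in the tree (the tree's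
  `Mok2014_weakBaseChange` is the almost-everywhere form, without archimedean clause and without
  the isobaric structure); it enters below as an explicit HYPOTHESIS in Satake form (`h12`,
  `hBC`), never as a new named fact (D-0026);
* (I2) the Galois representations of the regular algebraic (= cohomological, Clozel) cuspidal
  `Π_i := Π̃_i‖det‖^{(m_i+n_i-1)/2}` with unramified compatibility at every `v ∤ p` — in print
  "theorem 1.2 of [BLGHT]" (Barnet-Lamb–Geraghty–Harris–Taylor 2011, Thm. 1.2: regular
  algebraic, essentially conjugate self-dual cuspidal `π` over an imaginary CM field carry a
  "continuous semisimple representation `r_{l,ı}(π)`" with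
  `r_{l,ı}(π)|^{ss}_{G_{F_v}} = r_l(ı⁻¹π_v)^∨(1-n)^{ss}` at every `v ∤ l`), available in the
  tree in two EXISTING named facts: HLTT's own Theorem A `exists_galoisRep_of_regularAlgebraic`
  (`ReciprocityGLn.lean`; all regular algebraic `Π`; hypothesis `hA` — circular relative to the
  source, where Theorem A is deduced from Cor. 1.3) and
  `BLGGT2014_polarized_compatibleSystem_rationalModels` (`PolarizedCompatibleSystemRationalModels.lean`;
  Barnet-Lamb–Gee–Geraghty–Taylor 2014, Thm. 2.1.1 = [BLGHT, Thm. 1.2] for norm-polarized `Π`,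
  which the `Π_i` are: `Π_i^c ≅ Π_i^∨ ⊗ ‖det‖^{m_i+n_i-1}`; hypothesis `hB` — the printed,
  non-circular input);

and what is PROVED here is the combination: `r := ⊞_i ⊞_{j<n_i} r_{p,ı}(Π_i) ⊗ ε_p^{-(n+j)}`
is continuous semisimple, unramified at the good places, with the predicted characteristic
polynomial of arithmetic Frobenius.  On Satake parameters (`α(π ⊗ |det|^s) = α(π) q^{-s}`):
`α(Π̃_{i,v}|det|^{(n_i-1)/2-j}) = α(Π_{i,v}) q^{m_i/2 + j}`, and
`(√q)^{2n-1} · α (√q)^{m_i} q^j = ((√q)^{m_i-1} α) · q^{n+j}`, whence the twist `ε_p^{-(n+j)}`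
(`arithFrobPolyOfSatake` lists the INVERSE roots `ι⁻¹((q^{(N-1)/2} b)⁻¹)`, review 13 of
`ReciprocityGLn`).

## Contents

* assembly of framed Galois representations: `isSemisimple_blockSum`, `isSemisimple_twist`,
  `exists_iteratedBlockSum` (Fin-indexed block sums: semisimple, unramified, Frobenius polynomials
  multiply), `exists_tateTwist_semisimple`;
* Satake-polynomial algebra: `arithFrobPolyOfSatake_add/_sum`, `arithFrobPolyOfSatake_map_mul`,
  `sqrt_pow_mul_rescale` (the displayed identity), `symm_inv_rescale` (reusing
  `arithFrobPolyOfSatake_eq_prod_map` of `WeaklyRegularGaloisRepNormTwistProofs`);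
* `exists_galoisRep_of_constituents` — the combination step with the Galois representations of
  the constituents as DATA; `exists_galoisRep_of_isobaricData` (from `hA`) and
  `exists_galoisRep_of_polarizedConstituents` (from `hB`, norm-polarized constituents) are its
  corollaries;
* `corollary13_cuspidalUnitary_of_prop12` — the named fact from `hA` and the `∀`-quantified
  Satake form `h12` of Prop. 1.2;
* `corollary13_cuspidalUnitary_of_polarizedProp12` — the named fact from `hB` and Prop. 1.2 in
  Satake form with the conjugate self-duality of the constituents (the printed inputs);
* `corollary13_cuspidalUnitary_of_pos_rank` — the degenerate rank `n = 0` is proved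
  (`GoldringKoskivirta2019_galoisRep_unitary_rank_zero`), so a discharge may assume `0 < n`;
* `exists_galoisRep_of_polarizedProp12At` — the combination step AT ONE `σ'` (the conclusion of
  Cor. 1.3 for `σ'` from `hB` and the conclusion of Prop. 1.2 for `σ'`), for use with Prop. 1.2
  in any quantifier shape; `corollary13_cuspidalUnitary_of_polarizedProp12_pos` — the named fact
  from `hB` and Prop. 1.2 demanded only for `0 < n` and `K ⊇ E₀`; the section docstring before
  them records what a discharge still needs (status 2026-08-17);
* `exists_galoisRep_rank_zero`, `exists_galoisRep_semisimple_of_normTwist`,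
  `exists_galoisRep_of_normTwistConstituents`, `exists_galoisRep_of_normTwistProp12At`,
  `corollary13_cuspidalUnitary_of_normTwistProp12_pos` (appended 2026-08-17) — the same four
  statements with input (I2) in Fakhruddin–Pilloni's rendering, the EXISTING named fact
  `FakhruddinPilloni2021_galoisRep_of_weaklyRegular_normTwist` (Thm. 9.10 with Thm. 9.1; in the
  regular case Thm. 9.8 = [BLGHT, Thm. 1.2]), made semisimple by
  `FramedGaloisRep.exists_semisimplification` (Deligne–Serre 1974, 6.12); `h12` of verbatim the
  same type, so the named fact is proved modulo Prop. 1.2 and either rendering of (I2).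

## References

* M. Harris, K.-W. Lan, R. Taylor, J. Thorne, *On the rigid cohomology of certain Shimura
  varieties*, Res. Math. Sci. 3:37 (2016), §1.3, Prop. 1.2, Cor. 1.3 (pp. 29–31).
  [HarrisLanTaylorThorneRMS2016]
* T. Barnet-Lamb, D. Geraghty, M. Harris, R. Taylor, *A family of Calabi–Yau varieties and
  potential automorphy II*, Publ. RIMS 47 (2011), Thm. 1.2 (pp. 38–39). [BarnetlambEtAl2011]
* T. Barnet-Lamb, T. Gee, D. Geraghty, R. Taylor, *Potential automorphy and change of weight*,
  Ann. of Math. 179 (2014), Thm. 2.1.1. [BarnetlambEtAl2014]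
* J.-P. Serre, *Abelian ℓ-adic representations and elliptic curves* (1968), Ch. I §1.2, §2.3.
  [SerreAbelianLadic1968]
* N. Fakhruddin, V. Pilloni, *Hecke operators and the coherent cohomology of Shimura varieties*,
  J. Inst. Math. Jussieu (2021) = arXiv:1910.03790, §9.2, Thm. 9.8, Thm. 9.10, Thm. 9.1 (p. 44).
  [FakhruddinPilloni2021]
* P. Deligne, J.-P. Serre, *Formes modulaires de poids 1*, ASENS 7 (1974), 6.12
  (semisimplification). [DeligneSerreASENS1974]
-/

noncomputable section

open scoped MatrixGroups Matrix NumberField Polynomial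
open NumberField IsDedekindDomain Field Polynomial
open Literature.NumberTheory.GaloisRepresentations Literature.RepresentationTheory.Semisimple

namespace Literature.NumberTheory.Automorphic

namespace HarrisLanTaylorThorne2016

/-! ### Assembly of framed Galois representations -/

section Assembly

variable {K : Type} [Field K] {k : Type*} [Field k] [TopologicalSpace k] [IsTopologicalRing k]

/-- **A block sum of semisimple framed Galois representations is semisimple** (the direct sum of
semisimple representations over a field; `isSemisimpleRepresentation_of_blockDiag`). [folklore] -/
theorem isSemisimple_blockSum {m n : ℕ} {ρ₁ : FramedGaloisRep K k m} {ρ₂ : FramedGaloisRep K k n}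
    (h₁ : ρ₁.toGaloisRep.IsSemisimple) (h₂ : ρ₂.toGaloisRep.IsSemisimple) :
    (ρ₁.blockSum ρ₂).toGaloisRep.IsSemisimple :=
  isSemisimpleRepresentation_of_blockDiag (k := k) finSumFinEquiv (A := ρ₁.toMonoidHom)
    (D := ρ₂.toMonoidHom) (ψ := (FramedRep.blockSum ρ₁ ρ₂).toMonoidHom) (fun _ => rfl) h₁ h₂

/-- **Twisting by a continuous character preserves semisimplicity** (same lattice of stable
subspaces; `Representation.isSemisimpleRepresentation_twist_iff`). [folklore] -/
theorem isSemisimple_twist {n : ℕ} {ρ : FramedGaloisRep K k n} (h : ρ.toGaloisRep.IsSemisimple)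
    (χ : absoluteGaloisGroup K →ₜ* kˣ) :
    (FramedGaloisRep.toGaloisRep (FramedRep.twist ρ χ)).IsSemisimple := by
  have e : FramedRep.toRepresentation (FramedRep.twist ρ χ) =
      Representation.twist (FramedRep.toRepresentation ρ) χ.toMonoidHom := by
    refine MonoidHom.ext fun g => LinearMap.ext fun v => ?_
    change ((FramedRep.twist ρ χ g : GL (Fin n) k) : Matrix (Fin n) (Fin n) k) *ᵥ v =
      ((χ.toMonoidHom g : kˣ) : k) • (((ρ g : GL (Fin n) k) : Matrix (Fin n) (Fin n) k) *ᵥ v)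
    rw [FramedRep.coe_twist_apply, Matrix.smul_mulVec]
    rfl
  change (FramedRep.toRepresentation (FramedRep.twist ρ χ)).IsSemisimpleRepresentation
  rw [e]
  exact (Representation.isSemisimpleRepresentation_twist_iff _ _).mpr h

/-- **Iterated block sums.**  For framed Galois representations `ρ_i : Γ_K →ₜ* GL_{d_i}(k)`,
`i < r`, all semisimple, there is `R : Γ_K →ₜ* GL_N(k)`, `N = Σ d_i` (the block sum
`ρ_0 ⊞ (ρ_1 ⊞ ⋯)`), semisimple, unramified at every finite place where all `ρ_i` are, and on which
the arithmetic Frobenii at `v` have characteristic polynomial `∏_i P_i` whenever they have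
characteristic polynomial `P_i` on `ρ_i` (Serre 1968, Ch. I §2.3). [folklore] -/
theorem exists_iteratedBlockSum {r : ℕ} (d : Fin r → ℕ) {N : ℕ} (hN : ∑ i, d i = N)
    (ρ : ∀ i, FramedGaloisRep K k (d i)) (hss : ∀ i, (ρ i).toGaloisRep.IsSemisimple) :
    ∃ R : FramedGaloisRep K k N, R.toGaloisRep.IsSemisimple ∧
      ∀ v : HeightOneSpectrum (𝓞 K),
        ((∀ i, (ρ i).IsUnramifiedAt v) → R.IsUnramifiedAt v) ∧
        ∀ P : Fin r → k[X], (∀ i, (ρ i).HasFrobCharpolyAt v (P i)) →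
          R.HasFrobCharpolyAt v (∏ i, P i) := by
  induction r generalizing N with
  | zero =>
    simp only [Finset.univ_eq_empty, Finset.sum_empty] at hN
    subst hN
    refine ⟨1, ?_, fun v => ⟨fun _ => FramedGaloisRep.isUnramifiedAt_of_rank_zero v _, fun P _ => ?_⟩⟩
    · haveI : Subsingleton (Subrepresentation
          ((1 : FramedGaloisRep K k 0).toGaloisRep.toRepresentation)) :=
        ⟨fun a b ↦ Subrepresentation.toSubmodule_injective (Subsingleton.elim _ _)⟩
      exact Subsingleton.instComplementedLattice
    · rw [Finset.univ_eq_empty, Finset.prod_empty]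
      exact FramedGaloisRep.hasFrobCharpolyAt_one_of_rank_zero v _
  | succ r ih =>
    rw [Fin.sum_univ_succ] at hN
    obtain ⟨R', hR'ss, hR'⟩ := ih (fun i => d i.succ) rfl (fun i => ρ i.succ) (fun i => hss i.succ)
    subst hN
    refine ⟨(ρ 0).blockSum R', isSemisimple_blockSum (hss 0) hR'ss, fun v => ⟨fun h => ?_, fun P hP => ?_⟩⟩
    · exact FramedGaloisRep.IsUnramifiedAt.blockSum (h 0) ((hR' v).1 fun i => h i.succ)
    · rw [Fin.prod_univ_succ]
      exact FramedGaloisRep.HasFrobCharpolyAt.blockSum (hP 0) ((hR' v).2 (fun i => P i.succ) fun i => hP i.succ)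

end Assembly

/-! ### Semisimple Tate twists -/

section TateTwist

variable {K : Type} [Field K] [NumberField K] {p : ℕ} [Fact p.Prime]

/-- **Tate twists, with semisimplicity** (`FramedGaloisRep.exists_tateTwist` of
`TateTwistFrobeniusProofs`, same proof, recording that `r ⊗ ε_p^k` is semisimple when `r` is):
for `r : Γ_K →ₜ* GL_n(ℚ̄_p)` semisimple and `k ∈ ℤ` there is a semisimple `r'` such that at every
finite `v ∤ p`, `r'` is unramified if `r` is, and a Frobenius characteristic polynomial
`∏_{b ∈ β} (X - b)` on `r` becomes `∏_{b ∈ β} (X - q_v^k b)` on `r'`.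
[cite: SerreAbelianLadic1968, Ch. I §1.2 (Example: the cyclotomic character)] -/
theorem exists_tateTwist_semisimple {n : ℕ} (r : FramedGaloisRep K (PadicAlgCl p) n)
    (hr : r.toGaloisRep.IsSemisimple) (k : ℤ) :
    ∃ r' : FramedGaloisRep K (PadicAlgCl p) n, r'.toGaloisRep.IsSemisimple ∧
      ∀ v : HeightOneSpectrum (𝓞 K), ((p : ℕ) : 𝓞 K) ∉ v.asIdeal →
        (r.IsUnramifiedAt v → r'.IsUnramifiedAt v) ∧
        ∀ β : Multiset (PadicAlgCl p),
          r.HasFrobCharpolyAt v (β.map fun b => X - C b).prod →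
            r'.HasFrobCharpolyAt v
              ((β.map fun b => X - C ((v.residueCard : PadicAlgCl p) ^ k * b)).prod) := by
  obtain ⟨ε, hε⟩ := exists_cyclotomicCharacter_padicAlgCl_zpow K p k
  refine ⟨FramedRep.twist r ε, isSemisimple_twist hr ε, fun v hv => ⟨fun h => ?_, fun β h => ?_⟩⟩
  · exact FramedGaloisRep.isUnramifiedAt_twist h fun 𝔓 h𝔓 σ hσ =>
      eq_one_of_mem_inertia_of_cyclotomic_zpow hε hv h𝔓 hσ
  · exact FramedGaloisRep.hasFrobCharpolyAt_twist_of_eq_prod h fun 𝔓 h𝔓 σ hσ =>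
      coe_apply_of_isArithFrobAt_of_cyclotomic_zpow hε hv h𝔓 hσ

end TateTwist

/-! ### Algebra of the predicted Frobenius polynomials -/

section SatakeAlgebra

variable {p : ℕ} [Fact p.Prime]

/-- The predicted polynomial is multiplicative in the Satake multiset: `α + β ↦ P_α · P_β`.
[folklore] -/
theorem arithFrobPolyOfSatake_add (ι : PadicAlgCl p ≃+* ℂ) (q m : ℕ) (α β : Multiset ℂ) :
    arithFrobPolyOfSatake ι q m (α + β) =
      arithFrobPolyOfSatake ι q m α * arithFrobPolyOfSatake ι q m β := by
  simp only [arithFrobPolyOfSatake, Multiset.map_add, Multiset.prod_add]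

/-- The predicted polynomial of a finite sum of multisets is the product of the predicted
polynomials. [folklore] -/
theorem arithFrobPolyOfSatake_sum (ι : PadicAlgCl p ≃+* ℂ) (q m : ℕ) {ι' : Type*}
    (s : Finset ι') (f : ι' → Multiset ℂ) :
    arithFrobPolyOfSatake ι q m (∑ i ∈ s, f i) = ∏ i ∈ s, arithFrobPolyOfSatake ι q m (f i) := by
  classical
  induction s using Finset.induction_on with
  | empty => simp [arithFrobPolyOfSatake]
  | insert a s ha ih => rw [Finset.sum_insert ha, Finset.prod_insert ha, arithFrobPolyOfSatake_add, ih]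

/-- **Rescaled Satake multisets.**  If every `a ∈ α` satisfies
`ι⁻¹(((√q)^{N-1} (a c))⁻¹) = e · ι⁻¹(((√q)^{m-1} a)⁻¹)`, then the rank-`N` predicted polynomial of
the rescaled multiset `α · c` is `∏_{a ∈ α} (X - e · ι⁻¹(((√q)^{m-1} a)⁻¹))` — the Frobenius
polynomial of the rank-`m` representation twisted by a character with Frobenius value `e`.
[folklore] -/
theorem arithFrobPolyOfSatake_map_mul (ι : PadicAlgCl p ≃+* ℂ) (q N m : ℕ) (α : Multiset ℂ)
    (c : ℂ) (e : PadicAlgCl p)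
    (h : ∀ a ∈ α, ι.symm (((Real.sqrt q : ℝ) : ℂ) ^ (N - 1) * (a * c))⁻¹ =
      e * ι.symm (((Real.sqrt q : ℝ) : ℂ) ^ (m - 1) * a)⁻¹) :
    arithFrobPolyOfSatake ι q N (α.map (· * c)) =
      ((α.map fun a => ι.symm (((Real.sqrt q : ℝ) : ℂ) ^ (m - 1) * a)⁻¹).map
        fun b => X - C (e * b)).prod := by
  rw [arithFrobPolyOfSatake, Multiset.map_map, Multiset.map_map]
  congr 1
  exact Multiset.map_congr rfl fun a ha => by
    simp only [Function.comp_apply]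
    rw [h a ha]

/-- **The displayed identity** `(√q)^{2n-1} · (a (√q)^m q^j) = ((√q)^{m-1} a) · q^{n+j}` for
`m, n ≥ 1` (so that the natural-number subtractions do not truncate). [folklore] -/
theorem sqrt_pow_mul_rescale (q : ℕ) {m n : ℕ} (hm : 0 < m) (hn : 0 < n) (j : ℕ) (a : ℂ) :
    ((Real.sqrt q : ℝ) : ℂ) ^ (2 * n - 1) * (a * (((Real.sqrt q : ℝ) : ℂ) ^ m * (q : ℂ) ^ j)) =
      ((Real.sqrt q : ℝ) : ℂ) ^ (m - 1) * a * (q : ℂ) ^ (n + j) := by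
  set s : ℂ := ((Real.sqrt q : ℝ) : ℂ) with hs
  have hq : (q : ℂ) = s ^ 2 := by
    rw [hs, ← Complex.ofReal_pow, Real.sq_sqrt (Nat.cast_nonneg q), Complex.ofReal_natCast]
  have h1 : s ^ (2 * n - 1) * s ^ m = s ^ (m - 1) * (s ^ 2) ^ n := by
    rw [← pow_mul, ← pow_add, ← pow_add]
    congr 1
    omega
  calc s ^ (2 * n - 1) * (a * (s ^ m * (q : ℂ) ^ j))
      = (s ^ (2 * n - 1) * s ^ m) * a * (q : ℂ) ^ j := by ring
    _ = s ^ (m - 1) * (s ^ 2) ^ n * a * (q : ℂ) ^ j := by rw [h1]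
    _ = s ^ (m - 1) * a * (q : ℂ) ^ (n + j) := by rw [hq]; ring

/-- The rescaling hypothesis of `arithFrobPolyOfSatake_map_mul` for the `(i, j)`-th block of
HLTT's Prop. 1.2: with `c = (√q)^m q^j`, rank `N = 2n`, `m, n ≥ 1`, the factor is
`e = q^{-(n+j)}` in `ℚ̄_p` (`ι⁻¹` is multiplicative and fixes `q`). [folklore] -/
theorem symm_inv_rescale (ι : PadicAlgCl p ≃+* ℂ) (q : ℕ) {m n : ℕ} (hm : 0 < m) (hn : 0 < n)
    (j : ℕ) (a : ℂ) :
    ι.symm (((Real.sqrt q : ℝ) : ℂ) ^ (2 * n - 1) *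
        (a * (((Real.sqrt q : ℝ) : ℂ) ^ m * (q : ℂ) ^ j)))⁻¹ =
      (q : PadicAlgCl p) ^ (-((n + j : ℕ) : ℤ)) *
        ι.symm (((Real.sqrt q : ℝ) : ℂ) ^ (m - 1) * a)⁻¹ := by
  rw [sqrt_pow_mul_rescale q hm hn j a, mul_inv, map_mul, map_inv₀, map_inv₀,
    map_pow ι.symm (q : ℂ) (n + j), map_natCast, zpow_neg, zpow_natCast, mul_comm]

end SatakeAlgebra

/-! ### Cor. 1.3 from its two inputs -/

section Corollary13

variable {K : Type} [Field K] [NumberField K] {p : ℕ} [Fact p.Prime]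

/-- **The Galois representation of an isobaric datum of HLTT's shape, from the Galois
representations of its constituents** (the combination step of the printed proof of Cor. 1.3,
p. 31, with the Galois input as DATA rather than as a named fact).  Let `Π_i` (`i < r`) be
cuspidal on `GL_{m_i}(𝔸_K)`, `d_i ≥ 0` with `Σ_i m_i d_i = 2n`, suppose each `Π_i` carries a
continuous semisimple `ρ_i : Γ_K → GL_{m_i}(ℚ̄_p)` unramified with arithmetic Frobenius polynomial
`arithFrobPolyOfSatake ι q_v (m_i) α` at every `v ∤ p` where `Π_i` has Satake parameter `α`
(`hρ` — in print [BLGHT, Thm. 1.2] for the conjugate self-dual cohomological `Π_i`), and let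
`Good u β` be any predicate on finite places and complex multisets such that at every good
`(u, β)` with `u ∤ p` the `Π_i` have Satake parameters `α_i` at `u` with
`β = ⊎_i ⊎_{j<d_i} α_i · (√q_u)^{m_i} q_u^j` (`hBC` — in print Prop. 1.2 read on Satake
parameters).  Then `ρ = ⊞_i ⊞_{j<d_i} ρ_i ⊗ ε_p^{-(n+j)}` is a continuous semisimple
`Γ_K → GL_{2n}(ℚ̄_p)` which at every good `(u, β)`, `u ∤ p`, is unramified with arithmetic
Frobenius polynomial `arithFrobPolyOfSatake ι q_u (2n) β`, because
`(√q)^{2n-1} (a (√q)^{m_i} q^j) = ((√q)^{m_i-1} a) q^{n+j}` (`symm_inv_rescale`).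
[cite: HarrisLanTaylorThorneRMS2016, proof of Cor. 1.3 (p. 31)] -/
theorem exists_galoisRep_of_constituents (ι : PadicAlgCl p ≃+* ℂ) {n r : ℕ} {m d : Fin r → ℕ}
    (hmd : ∑ i, m i * d i = 2 * n) {hc : ∀ i, isCompact_glFiniteIntegralLevel (m i) K}
    (πc : ∀ i, CuspidalAutomorphicRepData (m i) K (hc i))
    (hρ : ∀ i, ∃ ρ : FramedGaloisRep K (PadicAlgCl p) (m i), ρ.toGaloisRep.IsSemisimple ∧
      ∀ (v : HeightOneSpectrum (𝓞 K)) (α : Multiset ℂ), (πc i).1.HasSatakeParamAt v α →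
        ((p : ℕ) : 𝓞 K) ∉ v.asIdeal →
          ρ.IsUnramifiedAt v ∧ ρ.HasFrobCharpolyAt v (arithFrobPolyOfSatake ι v.residueCard (m i) α))
    (Good : HeightOneSpectrum (𝓞 K) → Multiset ℂ → Prop)
    (hBC : ∀ (u : HeightOneSpectrum (𝓞 K)) (β : Multiset ℂ), ((p : ℕ) : 𝓞 K) ∉ u.asIdeal →
      Good u β → ∃ α : Fin r → Multiset ℂ, (∀ i, (πc i).1.HasSatakeParamAt u (α i)) ∧
        β = ∑ i, ∑ j ∈ Finset.range (d i), (α i).map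
          (· * ((((Real.sqrt (u.residueCard : ℝ) : ℝ) : ℂ)) ^ (m i) * (u.residueCard : ℂ) ^ j))) :
    ∃ ρ : FramedGaloisRep K (PadicAlgCl p) (2 * n), ρ.toGaloisRep.IsSemisimple ∧
      ∀ (u : HeightOneSpectrum (𝓞 K)) (β : Multiset ℂ), ((p : ℕ) : 𝓞 K) ∉ u.asIdeal → Good u β →
        ρ.IsUnramifiedAt u ∧ ρ.HasFrobCharpolyAt u (arithFrobPolyOfSatake ι u.residueCard (2 * n) β) := by
  classical
  -- (I2): the Galois representations of the constituents
  choose ρ hρss hρ using hρ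
  -- their Tate twists `ρ_i ⊗ ε_p^{-(n+j)}`, `j < d_i`
  choose τ hτss hτ using fun (i : Fin r) (j : Fin (d i)) =>
    exists_tateTwist_semisimple (ρ i) (hρss i) (-((n + (j : ℕ) : ℕ) : ℤ))
  -- the strings `S_i = ⊞_j τ_{i,j}` and the total block sum `R = ⊞_i S_i`
  choose S hSss hS using fun i => exists_iteratedBlockSum (K := K) (k := PadicAlgCl p)
    (fun _ : Fin (d i) => m i) (N := m i * d i) (by simp [mul_comm]) (τ i) (hτss i)
  obtain ⟨R, hRss, hR⟩ := exists_iteratedBlockSum (fun i => m i * d i) hmd S hSss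
  refine ⟨R, hRss, fun u β hu hgood => ?_⟩
  obtain ⟨α, hα, rfl⟩ := hBC u β hu hgood
  -- notation
  set q : ℕ := u.residueCard with hq
  set s : ℂ := ((Real.sqrt (q : ℝ) : ℝ) : ℂ) with hs
  -- the predicted polynomial of the `(i, j)`-th block
  let P : ∀ i, Fin (d i) → (PadicAlgCl p)[X] := fun i j =>
    (((α i).map fun a => ι.symm (s ^ (m i - 1) * a)⁻¹).map
      fun b => X - C ((q : PadicAlgCl p) ^ (-((n + (j : ℕ) : ℕ) : ℤ)) * b)).prod
  -- each block is unramified at `u` with polynomial `P i j`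
  have hblock : ∀ i (j : Fin (d i)), (τ i j).IsUnramifiedAt u ∧ (τ i j).HasFrobCharpolyAt u (P i j) := by
    intro i j
    obtain ⟨hunr, hpoly⟩ := hρ i u (α i) (hα i) hu
    rw [arithFrobPolyOfSatake_eq_prod_map] at hpoly
    exact ⟨(hτ i j u hu).1 hunr, (hτ i j u hu).2 _ hpoly⟩
  have hSi : ∀ i, (S i).IsUnramifiedAt u ∧ (S i).HasFrobCharpolyAt u (∏ j, P i j) := fun i =>
    ⟨(hS i u).1 fun j => (hblock i j).1, (hS i u).2 (P i) fun j => (hblock i j).2⟩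
  refine ⟨(hR u).1 fun i => (hSi i).1, ?_⟩
  -- the predicted polynomial of `β` is the product of the `P i j`
  have hP : arithFrobPolyOfSatake ι q (2 * n)
      (∑ i, ∑ j ∈ Finset.range (d i), (α i).map (· * (s ^ (m i) * (q : ℂ) ^ j))) =
      ∏ i, ∏ j, P i j := by
    rw [arithFrobPolyOfSatake_sum]
    refine Finset.prod_congr rfl fun i _ => ?_
    rw [arithFrobPolyOfSatake_sum, ← Fin.prod_univ_eq_prod_range]
    refine Finset.prod_congr rfl fun j _ => ?_
    by_cases hmi : m i = 0
    · -- an empty constituent: `α i = 0`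
      have hαi : α i = 0 := Multiset.card_eq_zero.mp (by rw [(hα i).card_eq, hmi])
      simp [P, hαi, arithFrobPolyOfSatake]
    · have hm : 0 < m i := Nat.pos_of_ne_zero hmi
      have hn : 0 < n := by
        have h1 : m i * d i ≤ ∑ k, m k * d k :=
          Finset.single_le_sum (fun k _ => Nat.zero_le (m k * d k)) (Finset.mem_univ i)
        have h2 : 0 < d i := Fin.pos j
        have h3 : 0 < m i * d i := Nat.mul_pos hm h2
        omega
      exact arithFrobPolyOfSatake_map_mul ι q (2 * n) (m i) (α i) _ _
        fun a _ => symm_inv_rescale ι q hm hn j a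
  rw [hP]
  exact (hR u).2 (fun i => ∏ j, P i j) fun i => (hSi i).2

/-- **The Galois representation of an isobaric datum of HLTT's shape** (the combination step of
the printed proof of Cor. 1.3, for any family of constituents).  Let `K` be totally real or CM,
`Π_i` (`i < r`) regular algebraic cuspidal on `GL_{m_i}(𝔸_K)`, `d_i ≥ 0` with
`Σ_i m_i d_i = 2n`, and let `Good u β` be any predicate on finite places and complex multisets
such that at every good `(u, β)` with `u ∤ p` the `Π_i` have Satake parameters `α_i` at `u` with
`β = ⊎_i ⊎_{j<d_i} α_i · (√q_u)^{m_i} q_u^j` (`hBC`; for HLTT this is Prop. 1.2 read on Satake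
parameters, `α(Π̃_{i,u}|det|^{(d_i-1)/2-j}) = α(Π_{i,u}) q_u^{m_i/2+j}` for
`Π_i = Π̃_i‖det‖^{(m_i+d_i-1)/2}`).  Granting the Galois representations of regular algebraic
cuspidal representations (`hA : exists_galoisRep_of_regularAlgebraic`), the block sum
`ρ = ⊞_i ⊞_{j<d_i} r_{p,ı}(Π_i) ⊗ ε_p^{-(n+j)}` is a continuous semisimple
`Γ_K → GL_{2n}(ℚ̄_p)` which at every good `(u, β)`, `u ∤ p`, is unramified with arithmetic
Frobenius polynomial `arithFrobPolyOfSatake ι q_u (2n) β` — because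
`(√q)^{2n-1} (a (√q)^{m_i} q^j) = ((√q)^{m_i-1} a) q^{n+j}` (`symm_inv_rescale`).
A corollary of `exists_galoisRep_of_constituents`.
[cite: HarrisLanTaylorThorneRMS2016, proof of Cor. 1.3 (p. 31)] -/
theorem exists_galoisRep_of_isobaricData (hA : exists_galoisRep_of_regularAlgebraic)
    (hK : IsTotallyReal K ∨ IsCMField K) (ι : PadicAlgCl p ≃+* ℂ) {n r : ℕ} {m d : Fin r → ℕ}
    (hmd : ∑ i, m i * d i = 2 * n) {hc : ∀ i, isCompact_glFiniteIntegralLevel (m i) K}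
    (πc : ∀ i, CuspidalAutomorphicRepData (m i) K (hc i)) (hπc : ∀ i, (πc i).1.IsRegularAlgebraic)
    (Good : HeightOneSpectrum (𝓞 K) → Multiset ℂ → Prop)
    (hBC : ∀ (u : HeightOneSpectrum (𝓞 K)) (β : Multiset ℂ), ((p : ℕ) : 𝓞 K) ∉ u.asIdeal →
      Good u β → ∃ α : Fin r → Multiset ℂ, (∀ i, (πc i).1.HasSatakeParamAt u (α i)) ∧
        β = ∑ i, ∑ j ∈ Finset.range (d i), (α i).map
          (· * ((((Real.sqrt (u.residueCard : ℝ) : ℝ) : ℂ)) ^ (m i) * (u.residueCard : ℂ) ^ j))) :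
    ∃ ρ : FramedGaloisRep K (PadicAlgCl p) (2 * n), ρ.toGaloisRep.IsSemisimple ∧
      ∀ (u : HeightOneSpectrum (𝓞 K)) (β : Multiset ℂ), ((p : ℕ) : 𝓞 K) ∉ u.asIdeal → Good u β →
        ρ.IsUnramifiedAt u ∧ ρ.HasFrobCharpolyAt u (arithFrobPolyOfSatake ι u.residueCard (2 * n) β) :=
  exists_galoisRep_of_constituents ι hmd πc (fun i => hA (hc i) hK (πc i) (hπc i) p ι) Good hBC

/-- **The Galois representation of an isobaric datum with regular algebraic NORM-POLARIZED
constituents** — the combination step of the printed proof of Cor. 1.3 with the Galois input of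
that proof: "theorem 1.2 of [BLGHT]" (Barnet-Lamb–Geraghty–Harris–Taylor, PRIMS 47 (2011),
Thm. 1.2, pp. 38–39: "Let `F` be an imaginary CM field … Suppose that `π` is a RAECSDC
automorphic representation of `GL_n(𝔸_F)` of weight `a`. Specifically suppose that
`π^∨ ≅ π^c (χ ∘ N_{F/F⁺})` where `χ : 𝔸_{F⁺}^×/(F⁺)^× → ℂ^×` is a continuous character with
`χ_v(-1)` independent of `v ∣ ∞`. Then there is a continuous semisimple representation
`r_{l,ı}(π) : Gal(F̄/F) → GL_n(ℚ̄_l)` with the following properties: 1. For every prime `v ∤ l`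
of `F` we have `r_{l,ı}(π)|^{ss}_{Gal(F̄_v/F_v)} = r_l(ı⁻¹π_v)^∨(1-n)^{ss}`. …"), in the tree the
EXISTING named fact `BLGGT2014_polarized_compatibleSystem_rationalModels`
(`PolarizedCompatibleSystemRationalModels.lean`: Barnet-Lamb–Gee–Geraghty–Taylor 2014, Thm. 2.1.1
— the same theorem restated for polarized `(π, χ)` — bundled with the `E_λ`-rational models of
Lemma 5.3.1 (3), which are not used here), for the norm powers `χ = ‖·‖_𝔸^k`
(`‖·‖_{𝔸_K}^k = ‖·‖_{𝔸_{K⁺}}^k ∘ N_{K/K⁺}`, sign condition met).  For HLTT's constituents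
`Π_i = Π̃_i‖det‖^{(m_i+n_i-1)/2}` with `Π̃_i^∨ ≅ Π̃_i^c` (Prop. 1.2) one has
`Π_i^c ≅ Π_i^∨ ⊗ ‖det‖^{m_i+n_i-1}`, a norm polarisation.  So: `K` CM, `Π_i` regular algebraic
cuspidal on `GL_{m_i}(𝔸_K)` with `Π_i^c ≅ Π_i^∨ ⊗ (χ_i ∘ det)`, `χ_i = ‖·‖_𝔸^{k_i}`
(`IsEssConjSelfDual`), `Σ m_i d_i = 2n`, and `hBC` as in `exists_galoisRep_of_constituents` ⇒ the
conclusion of Cor. 1.3 at the good places.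
[cite: HarrisLanTaylorThorneRMS2016, proof of Cor. 1.3 (p. 31)]
[cite: BarnetlambEtAl2014, Thm. 2.1.1] -/
theorem exists_galoisRep_of_polarizedConstituents [IsCMField K]
    (hB : BLGGT2014_polarized_compatibleSystem_rationalModels) (ι : PadicAlgCl p ≃+* ℂ) {n r : ℕ}
    {m d : Fin r → ℕ} (hmd : ∑ i, m i * d i = 2 * n)
    {hc : ∀ i, isCompact_glFiniteIntegralLevel (m i) K}
    (πc : ∀ i, CuspidalAutomorphicRepData (m i) K (hc i)) (hπc : ∀ i, (πc i).1.IsRegularAlgebraic)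
    (hpol : ∀ i, ∃ (χ : HeckeCharacter K) (k : ℤ),
      (∀ x : ideleGroup K, ((χ x : ℂˣ) : ℂ) = (ideleNorm x : ℂ) ^ (k : ℂ)) ∧
        (πc i).1.IsEssConjSelfDual χ)
    (Good : HeightOneSpectrum (𝓞 K) → Multiset ℂ → Prop)
    (hBC : ∀ (u : HeightOneSpectrum (𝓞 K)) (β : Multiset ℂ), ((p : ℕ) : 𝓞 K) ∉ u.asIdeal →
      Good u β → ∃ α : Fin r → Multiset ℂ, (∀ i, (πc i).1.HasSatakeParamAt u (α i)) ∧
        β = ∑ i, ∑ j ∈ Finset.range (d i), (α i).map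
          (· * ((((Real.sqrt (u.residueCard : ℝ) : ℝ) : ℂ)) ^ (m i) * (u.residueCard : ℂ) ^ j))) :
    ∃ ρ : FramedGaloisRep K (PadicAlgCl p) (2 * n), ρ.toGaloisRep.IsSemisimple ∧
      ∀ (u : HeightOneSpectrum (𝓞 K)) (β : Multiset ℂ), ((p : ℕ) : 𝓞 K) ∉ u.asIdeal → Good u β →
        ρ.IsUnramifiedAt u ∧ ρ.HasFrobCharpolyAt u (arithFrobPolyOfSatake ι u.residueCard (2 * n) β) := by
  refine exists_galoisRep_of_constituents ι hmd πc (fun i => ?_) Good hBC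
  obtain ⟨E, -, hE⟩ := hB (m i) K (hc i) (πc i) (hπc i) (hpol i)
  obtain ⟨ρ, hρ, -⟩ := hE p ι
  exact ⟨ρ, hρ⟩

/-- **A totally complex quadratic extension of a totally real field is CM** (Mathlib
`IsCMField.ofCMExtension`). [folklore] -/
theorem isCMField_of_finrank_eq_two {Fp : Type} [Field Fp] [NumberField Fp] [Algebra Fp K]
    (hFp : IsTotallyReal Fp) (hdeg : Module.finrank Fp K = 2) (hKc : IsTotallyComplex K) :
    IsCMField K := by
  haveI := hFp
  haveI := hKc
  haveI : Algebra.IsQuadraticExtension Fp K := { finrank_eq_two' := hdeg }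
  exact IsCMField.ofCMExtension Fp K

/-- **Harris–Lan–Taylor–Thorne 2016, Cor. 1.3 (cuspidal unitary case, as the named fact
`HarrisLanTaylorThorne2016_corollary13_cuspidalUnitary`) from its two printed inputs** — the
printed proof, p. 31: "Combine the proposition with, for instance, theorem 1.2 of [BLGHT] and
theorem A of [BLGGT]."

* `hA : exists_galoisRep_of_regularAlgebraic` — the Galois representations attached to regular
  algebraic cuspidal automorphic representations of `GL_m` over a CM field, with unramified
  compatibility at every `v ∤ p` (the tree's named fact for [BLGHT, Thm. 1.2] / [BLGGT, Thm. A] /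
  Chenevier–Harris, here needed only for the conjugate self-dual cohomological `Π_i`).
* `h12` — **Prop. 1.2** (p. 30: "Suppose that `Π` is a square integrable automorphic
  representation of `G_n(𝔸)` and that `Π_∞` is cohomological. Then there is an expression
  `2n = m_1 n_1 + ⋯ + m_r n_r` with `m_i, n_i ∈ ℤ_{>0}` and cuspidal automorphic representations
  `Π̃_i` of `GL_{m_i}(𝔸_F)` such that • `Π̃_i^∨ ≅ Π̃_i^c`; • `Π̃_i ‖det‖^{(m_i+n_i-1)/2}` is
  cohomological; • if `v` is a prime of `F` above a rational prime `q` such that either `q`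
  splits in `F₀`, or `F` and `Π` are unramified above `q`, then
  `BC(Π_q)_v = ⊞_{i=1}^r ⊞_{j=0}^{n_i-1} Π̃_{i,v} |det|_v^{(n_i-1)/2-j}`.  Proof: This follows from
  the main theorem of [Shin] and the classification of square integrable automorphic
  representations of `GL_m(𝔸_F)` in [MW]. (Here we are using our assumption that `F` contains
  an imaginary quadratic field.)"), rendered in the vocabulary and with the hypotheses of the
  fact it serves (see the docstring of `HarrisLanTaylorThorne2016_corollary13_cuspidalUnitary`
  for the passage `U → GU`, Fakhruddin–Pilloni 2021 proof of Thm. 9.11, and for "`F` and `Π`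
  unramified above `q`"): for `σ'` cuspidal on Mok's `U_{K/Fp}(2n)` with regular discrete series
  at the `cK`-fixed complex places, `K ⊇ E₀` imaginary quadratic, there are `r`, `m_i`,
  `d_i = n_i` with `Σ m_i d_i = 2n` and REGULAR ALGEBRAIC cuspidal
  `Π_i := Π̃_i‖det‖^{(m_i+n_i-1)/2}` on `GL_{m_i}(𝔸_K)` (cohomological = regular algebraic for
  `GL_m`, Clozel 1990, Lemme 3.14) such that at every finite place `u` of `K` over a rational
  prime above which `K` is unramified and `σ'` is unramified everywhere, every base-change Satake
  parameter `β` of `σ'` at `u` (`UnitaryGroup.HasBaseChangeSatakeAt`) is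
  `⊎_i ⊎_{j<d_i} α_i · (√q_u)^{m_i} q_u^j` for Satake parameters `α_i` of the `Π_i` at `u` — the
  displayed identity on Satake parameters, since `α(π ⊗ |det|^s) = α(π) q^{-s}` gives
  `α(Π̃_{i,u}|det|^{(n_i-1)/2-j}) = α(Π_{i,u}) q_u^{(m_i+n_i-1)/2-(n_i-1)/2+j}`.  Weaker than
  print (positivity of `m_i, n_i`, conjugate self-duality and the alternative "`q` splits in
  `F₀`" are not demanded).  A HYPOTHESIS of this theorem, not a named fact (D-0026): Shin's base
  change is not in the tree.

Given both, the fact follows from `exists_galoisRep_of_isobaricData` (`K` is CM: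
`isCMField_of_finrank_eq_two`); the hypothesis "`p` split in `E₀`" of the fact is not needed for
this step.
[cite: HarrisLanTaylorThorneRMS2016, Cor. 1.3 and its proof, Prop. 1.2 (pp. 30–31)] -/
theorem corollary13_cuspidalUnitary_of_prop12 (hA : exists_galoisRep_of_regularAlgebraic)
    (h12 : ∀ (Fp K : Type) [Field Fp] [NumberField Fp] [Field K] [NumberField K] [Algebra Fp K]
      (cK : K ≃ₐ[Fp] K), IsTotallyReal Fp → Module.finrank Fp K = 2 → ∀ (hc : cK ≠ 1),
      IsTotallyComplex K → ∀ (n : ℕ) (E₀ : IntermediateField ℚ K),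
      Module.finrank ℚ E₀ = 2 ∧ IsTotallyComplex E₀ →
      ∀ (hcptK : isCompact_glFiniteIntegralLevel (2 * n) K)
        (σ' : UnitaryGroup.CuspidalAutomorphicRepData Fp K cK (2 * n) hcptK),
      (∀ (w : {w : InfinitePlace K // w.IsComplex}) (hw : cK • w.1 = w.1),
        ∃ (a b : ℕ) (d : LDSDatum a b), d.IsRegular ∧
          UnitaryGroup.IsNondegenerateLimitOfDiscreteSeriesAt Fp K cK (2 * n)
            (StdForm.antidiagonal (2 * n)) hcptK σ'.1 hw hc d) →
      ∃ (r : ℕ) (m d : Fin r → ℕ) (_ : ∑ i, m i * d i = 2 * n)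
        (hc' : ∀ i, isCompact_glFiniteIntegralLevel (m i) K)
        (πc : ∀ i, CuspidalAutomorphicRepData (m i) K (hc' i)),
        (∀ i, (πc i).1.IsRegularAlgebraic) ∧
        ∀ (u : HeightOneSpectrum (𝓞 K)) (β : Multiset ℂ),
          (∀ u' : HeightOneSpectrum (𝓞 K), u'.asIdeal.under ℤ = u.asIdeal.under ℤ →
            u'.asIdeal.ramificationIdx ℤ = 1 ∧
              UnitaryGroup.IsUnramifiedAt Fp K cK (2 * n) hcptK σ'.1 u') →
          UnitaryGroup.HasBaseChangeSatakeAt Fp K cK (2 * n) hcptK σ'.1 u β →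
          ∃ α : Fin r → Multiset ℂ, (∀ i, (πc i).1.HasSatakeParamAt u (α i)) ∧
            β = ∑ i, ∑ j ∈ Finset.range (d i), (α i).map
              (· * ((((Real.sqrt (u.residueCard : ℝ) : ℝ) : ℂ)) ^ (m i) * (u.residueCard : ℂ) ^ j))) :
    HarrisLanTaylorThorne2016_corollary13_cuspidalUnitary := by
  intro Fp K _ _ _ _ _ cK hFp hdeg hc hKc n p _ ι E₀ hE₀ _ hcptK σ' hds
  obtain ⟨r, m, d, hmd, hc', πc, hreg, hBC⟩ := h12 Fp K cK hFp hdeg hc hKc n E₀ hE₀ hcptK σ' hds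
  obtain ⟨ρ, hρss, hρ⟩ := exists_galoisRep_of_isobaricData (p := p) hA
    (Or.inr (isCMField_of_finrank_eq_two hFp hdeg hKc)) ι hmd πc hreg
    (fun u β => (∀ u' : HeightOneSpectrum (𝓞 K), u'.asIdeal.under ℤ = u.asIdeal.under ℤ →
        u'.asIdeal.ramificationIdx ℤ = 1 ∧
          UnitaryGroup.IsUnramifiedAt Fp K cK (2 * n) hcptK σ'.1 u') ∧
      UnitaryGroup.HasBaseChangeSatakeAt Fp K cK (2 * n) hcptK σ'.1 u β)
    (fun u β _ hg => hBC u β hg.1 hg.2)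
  exact ⟨ρ, hρss, fun u β hu hgood hβ => hρ u β hu ⟨hgood, hβ⟩⟩

/-! ### Cor. 1.3 from Prop. 1.2 and [BLGHT, Thm. 1.2] — both inputs as printed

`corollary13_cuspidalUnitary_of_prop12` takes the Galois input in the form of HLTT's OWN
Theorem A (`exists_galoisRep_of_regularAlgebraic`), which Harris–Lan–Taylor–Thorne prove later in
the same paper FROM Cor. 1.3 (Cor. 6.27, Thm. 7.13); as a dependency that is circular relative to
the source (and to the tree's plan for Theorem A, whose `GL₂` case is derived from
`HarrisLanTaylorThorne2016_corollary13_cuspidalUnitary`).  The theorem below takes instead the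
printed input "theorem 1.2 of [BLGHT]" — Galois representations of regular algebraic
essentially conjugate self-dual cuspidal representations, proved through the cohomology of
compact unitary Shimura varieties (Shin, Chenevier–Harris, Caraiani), upstream of everything in
HLTT — in the tree the existing named fact `BLGGT2014_polarized_compatibleSystem_rationalModels`
(norm polarisations), together with Prop. 1.2 in Satake form INCLUDING the conjugate
self-duality of the constituents ("`Π̃_i^∨ ≅ Π̃_i^c`", i.e. `Π_i^c ≅ Π_i^∨ ⊗ ‖det‖^{m_i+n_i-1}`
for `Π_i = Π̃_i‖det‖^{(m_i+n_i-1)/2}`, rendered as a norm polarisation `IsEssConjSelfDual Π_i χ_i`,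
`χ_i = ‖·‖_𝔸^{k_i}`, the exponent left existential). -/

/-- **Harris–Lan–Taylor–Thorne 2016, Cor. 1.3 (cuspidal unitary case) from its two PRINTED
inputs: Prop. 1.2 (Shin's cohomological base change, with the conjugate self-duality of the
constituents) and [BLGHT, Thm. 1.2] (Galois representations of regular algebraic, essentially
conjugate self-dual cuspidal representations).**

* `hB : BLGGT2014_polarized_compatibleSystem_rationalModels` — the existing named fact for
  [BLGGT, Thm. 2.1.1] = [BLGHT, Thm. 1.2] at norm polarisations (its rational-model clause is not
  used): for `K` CM and `Π` regular algebraic cuspidal on `GL_m(𝔸_K)` with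
  `Π^c ≅ Π^∨ ⊗ (χ ∘ det)`, `χ = ‖·‖_𝔸^k`, and every `ℓ`, `ι`, a continuous SEMISIMPLE
  `r : Γ_K → GL_m(ℚ̄_ℓ)` unramified with arithmetic-Frobenius polynomial
  `arithFrobPolyOfSatake ι q_v m α` wherever `Π` has Satake parameter `α`, `v ∤ ℓ`.
* `h12` — **Prop. 1.2** (p. 30: "Suppose that `Π` is a square integrable automorphic
  representation of `G_n(𝔸)` and that `Π_∞` is cohomological. Then there is an expression
  `2n = m_1 n_1 + ⋯ + m_r n_r` with `m_i, n_i ∈ ℤ_{>0}` and cuspidal automorphic representations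
  `Π̃_i` of `GL_{m_i}(𝔸_F)` such that • `Π̃_i^∨ ≅ Π̃_i^c`; • `Π̃_i ‖det‖^{(m_i+n_i-1)/2}` is
  cohomological; • if `v` is a prime of `F` above a rational prime `q` such that either `q`
  splits in `F₀`, or `F` and `Π` are unramified above `q`, then
  `BC(Π_q)_v = ⊞_{i=1}^r ⊞_{j=0}^{n_i-1} Π̃_{i,v} |det|_v^{(n_i-1)/2-j}`."), rendered in the
  vocabulary and with the hypotheses of the fact it serves (docstring of
  `HarrisLanTaylorThorne2016_corollary13_cuspidalUnitary`: `U → GU` by Fakhruddin–Pilloni 2021,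
  proof of Thm. 9.11; "`F` and `Π` unramified above `q`"): for `K/Fp` CM (`[IsCMField K]` is
  carried as an instance binder; it follows from the other hypotheses,
  `isCMField_of_finrank_eq_two`), `K ⊇ E₀` imaginary quadratic, `σ'` cuspidal on Mok's
  `U_{K/Fp}(2n)` with regular discrete series at the `cK`-fixed complex places, there are `r`,
  `m_i`, `d_i = n_i` with `Σ m_i d_i = 2n` and cuspidal `Π_i := Π̃_i‖det‖^{(m_i+n_i-1)/2}` on
  `GL_{m_i}(𝔸_K)` which are REGULAR ALGEBRAIC (cohomological = regular algebraic for `GL_m`,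
  Clozel 1990, Lemme 3.14) and NORM-POLARIZED (`Π_i^c ≅ Π_i^∨ ⊗ (χ_i ∘ det)` for a Hecke
  character `χ_i = ‖·‖_𝔸^{k_i}`, `k_i ∈ ℤ` — from `Π̃_i^∨ ≅ Π̃_i^c`, with `k_i = m_i + n_i - 1`;
  the exponent is left existential), such that at every finite place `u` of `K` over a rational
  prime above which `K` is unramified and `σ'` is unramified everywhere, every base-change Satake
  parameter `β` of `σ'` at `u` is `⊎_i ⊎_{j<d_i} α_i · (√q_u)^{m_i} q_u^j` for Satake parameters
  `α_i` of the `Π_i` at `u` (`α(π ⊗ |det|^s) = α(π) q^{-s}`).  Weaker than print (positivity of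
  `m_i, n_i`, the value of `k_i` and the alternative "`q` splits in `F₀`" are not demanded).  A
  HYPOTHESIS of this theorem, not a named fact (D-0026): Shin's base change is not in the tree.

Given both, the fact follows from `exists_galoisRep_of_polarizedConstituents`; the hypothesis
"`p` split in `E₀`" of the fact is not needed for this step.
[cite: HarrisLanTaylorThorneRMS2016, Cor. 1.3 and its proof, Prop. 1.2 (pp. 30–31)]
[cite: BarnetlambEtAl2014, Thm. 2.1.1] -/
theorem corollary13_cuspidalUnitary_of_polarizedProp12
    (hB : BLGGT2014_polarized_compatibleSystem_rationalModels)
    (h12 : ∀ (Fp K : Type) [Field Fp] [NumberField Fp] [Field K] [NumberField K] [IsCMField K]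
      [Algebra Fp K] (cK : K ≃ₐ[Fp] K), IsTotallyReal Fp → Module.finrank Fp K = 2 →
      ∀ (hc : cK ≠ 1), IsTotallyComplex K → ∀ (n : ℕ) (E₀ : IntermediateField ℚ K),
      Module.finrank ℚ E₀ = 2 ∧ IsTotallyComplex E₀ →
      ∀ (hcptK : isCompact_glFiniteIntegralLevel (2 * n) K)
        (σ' : UnitaryGroup.CuspidalAutomorphicRepData Fp K cK (2 * n) hcptK),
      (∀ (w : {w : InfinitePlace K // w.IsComplex}) (hw : cK • w.1 = w.1),
        ∃ (a b : ℕ) (d : LDSDatum a b), d.IsRegular ∧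
          UnitaryGroup.IsNondegenerateLimitOfDiscreteSeriesAt Fp K cK (2 * n)
            (StdForm.antidiagonal (2 * n)) hcptK σ'.1 hw hc d) →
      ∃ (r : ℕ) (m d : Fin r → ℕ) (_ : ∑ i, m i * d i = 2 * n)
        (hc' : ∀ i, isCompact_glFiniteIntegralLevel (m i) K)
        (πc : ∀ i, CuspidalAutomorphicRepData (m i) K (hc' i)),
        (∀ i, (πc i).1.IsRegularAlgebraic) ∧
        (∀ i, ∃ (χ : HeckeCharacter K) (k : ℤ),
          (∀ x : ideleGroup K, ((χ x : ℂˣ) : ℂ) = (ideleNorm x : ℂ) ^ (k : ℂ)) ∧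
            (πc i).1.IsEssConjSelfDual χ) ∧
        ∀ (u : HeightOneSpectrum (𝓞 K)) (β : Multiset ℂ),
          (∀ u' : HeightOneSpectrum (𝓞 K), u'.asIdeal.under ℤ = u.asIdeal.under ℤ →
            u'.asIdeal.ramificationIdx ℤ = 1 ∧
              UnitaryGroup.IsUnramifiedAt Fp K cK (2 * n) hcptK σ'.1 u') →
          UnitaryGroup.HasBaseChangeSatakeAt Fp K cK (2 * n) hcptK σ'.1 u β →
          ∃ α : Fin r → Multiset ℂ, (∀ i, (πc i).1.HasSatakeParamAt u (α i)) ∧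
            β = ∑ i, ∑ j ∈ Finset.range (d i), (α i).map
              (· * ((((Real.sqrt (u.residueCard : ℝ) : ℝ) : ℂ)) ^ (m i) * (u.residueCard : ℂ) ^ j))) :
    HarrisLanTaylorThorne2016_corollary13_cuspidalUnitary := by
  intro Fp K _ _ _ _ _ cK hFp hdeg hc hKc n p _ ι E₀ hE₀ _ hcptK σ' hds
  haveI : IsCMField K := isCMField_of_finrank_eq_two hFp hdeg hKc
  obtain ⟨r, m, d, hmd, hc', πc, hreg, hpol, hBC⟩ :=
    h12 Fp K cK hFp hdeg hc hKc n E₀ hE₀ hcptK σ' hds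
  obtain ⟨ρ, hρss, hρ⟩ := exists_galoisRep_of_polarizedConstituents (p := p) hB ι hmd πc hreg hpol
    (fun u β => (∀ u' : HeightOneSpectrum (𝓞 K), u'.asIdeal.under ℤ = u.asIdeal.under ℤ →
        u'.asIdeal.ramificationIdx ℤ = 1 ∧
          UnitaryGroup.IsUnramifiedAt Fp K cK (2 * n) hcptK σ'.1 u') ∧
      UnitaryGroup.HasBaseChangeSatakeAt Fp K cK (2 * n) hcptK σ'.1 u β)
    (fun u β _ hg => hBC u β hg.1 hg.2)
  exact ⟨ρ, hρss, fun u β hu hgood hβ => hρ u β hu ⟨hgood, hβ⟩⟩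

/-! ### The degenerate rank `n = 0` -/

/-- **Reduction of a discharge to positive rank.**
`HarrisLanTaylorThorne2016_corollary13_cuspidalUnitary` quantifies over every `n : ℕ`; its case
`n = 0` (rank `2 * 0 = 0`: HLTT's `G_0`, whose unitary group is trivial) is the proved
`GoldringKoskivirta2019_galoisRep_unitary_rank_zero` (the trivial homomorphism `Γ_K → GL_0`; a
base-change Satake parameter in rank `0` is empty), so the fact follows from its own restriction
to `0 < n` — the genuine content (Prop. 1.2 has `m_i, n_i ∈ ℤ_{>0}`, `2n ≥ 1`).  A `theorem`
with the restricted statement as hypothesis; no new named fact. [folklore] -/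
theorem corollary13_cuspidalUnitary_of_pos_rank
    (h : ∀ (Fp K : Type) [Field Fp] [NumberField Fp] [Field K] [NumberField K] [Algebra Fp K]
      (cK : K ≃ₐ[Fp] K), IsTotallyReal Fp → Module.finrank Fp K = 2 → ∀ (hc : cK ≠ 1),
      IsTotallyComplex K → ∀ (n : ℕ), 0 < n → ∀ (p : ℕ) [Fact p.Prime] (ι : PadicAlgCl p ≃+* ℂ)
      (E₀ : IntermediateField ℚ K), Module.finrank ℚ E₀ = 2 ∧ IsTotallyComplex E₀ →
      HasTwoPrimesOver E₀ p →
      ∀ (hcptK : isCompact_glFiniteIntegralLevel (2 * n) K)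
        (σ' : UnitaryGroup.CuspidalAutomorphicRepData Fp K cK (2 * n) hcptK),
      (∀ (w : {w : InfinitePlace K // w.IsComplex}) (hw : cK • w.1 = w.1),
        ∃ (a b : ℕ) (d : LDSDatum a b), d.IsRegular ∧
          UnitaryGroup.IsNondegenerateLimitOfDiscreteSeriesAt Fp K cK (2 * n)
            (StdForm.antidiagonal (2 * n)) hcptK σ'.1 hw hc d) →
      ∃ r : FramedGaloisRep K (PadicAlgCl p) (2 * n), r.toGaloisRep.IsSemisimple ∧
        ∀ (u : HeightOneSpectrum (𝓞 K)) (β : Multiset ℂ), ((p : ℕ) : 𝓞 K) ∉ u.asIdeal →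
          (∀ u' : HeightOneSpectrum (𝓞 K), u'.asIdeal.under ℤ = u.asIdeal.under ℤ →
            u'.asIdeal.ramificationIdx ℤ = 1 ∧
              UnitaryGroup.IsUnramifiedAt Fp K cK (2 * n) hcptK σ'.1 u') →
          UnitaryGroup.HasBaseChangeSatakeAt Fp K cK (2 * n) hcptK σ'.1 u β →
            r.IsUnramifiedAt u ∧
              r.HasFrobCharpolyAt u (arithFrobPolyOfSatake ι u.residueCard (2 * n) β)) :
    HarrisLanTaylorThorne2016_corollary13_cuspidalUnitary := by
  intro Fp K _ _ _ _ _ cK hFp hdeg hc hKc n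
  obtain _ | n := n
  · intro p _ ι E₀ _ _ hcptK σ' _
    obtain ⟨r, hr, hr'⟩ := GoldringKoskivirta2019_galoisRep_unitary_rank_zero Fp K cK p ι hcptK σ'
    exact ⟨r, hr, fun u β _ _ hβ ↦ hr' u β hβ⟩
  · exact h Fp K cK hFp hdeg hc hKc (n + 1) n.succ_pos

/-! ### Pointwise form of the combination, and what a discharge still needs (status 2026-08-17)

The two theorems below close the bookkeeping of this file.

* `exists_galoisRep_of_polarizedProp12At` is the combination step AT ONE `σ'`: the conclusion of
  Cor. 1.3 for a given cuspidal `σ'` on `U_{K/Fp}(2n)` from [BLGHT, Thm. 1.2] (`hB`) and the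
  conclusion of Prop. 1.2 for THAT `σ'` (`h12`, an `∃` over the constituents).  It is the form to
  use with Prop. 1.2 vendored in ANY quantifier shape (only for `0 < n`, only under `K ⊇ E₀`,
  with or without positivity of the `m_i, n_i`, …): instantiate the vendored statement at `σ'`
  and feed the resulting existential here.
* `corollary13_cuspidalUnitary_of_polarizedProp12_pos` is the named fact from `hB` and Prop. 1.2
  demanded only in POSITIVE rank `0 < n` and under the standing hypothesis `K ⊇ E₀` of [HLTT, §1]
  (the rank `n = 0` being `corollary13_cuspidalUnitary_of_pos_rank`).

**Status of a discharge of `HarrisLanTaylorThorne2016_corollary13_cuspidalUnitary`.**  The fact is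
PROVED here MODULO exactly the two inputs of its printed proof: (I2) the existing named fact
`BLGGT2014_polarized_compatibleSystem_rationalModels` ([BLGGT, Thm. 2.1.1] = [BLGHT, Thm. 1.2];
Shimura varieties — not provable in the tree today), and (I1) Prop. 1.2 = Shin's cohomological
base change `G_n → GL_{2n}` with Mœglin–Waldspurger ([HLTT, Prop. 1.2, pp. 30–31]: "This follows
from the main theorem of [Shin, App. A to Goldring, Compos. Math. 150 (2014)] and … [MW]"), which
is NOT a declaration of the tree: no unitary base change with compatibility at EVERY unramified
place exists there (`Mok2014_weakBaseChange` is the almost-everywhere form without archimedean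
clause).  Its tree statement is, verbatim, the TYPE of the hypothesis `h12` of
`corollary13_cuspidalUnitary_of_polarizedProp12` (all ranks) or of
`corollary13_cuspidalUnitary_of_polarizedProp12_pos` (positive rank); it elaborates as a closed
`Prop` (checked 2026-08-17).  A fact-proving seat may not declare it (D-0026, gate
`lint.fact-fanout`, dry-run 2026-08-17: "larger decompositions happen at the ROUTE level"); the
consumer of this fact (crux `GaloisRepGL2CMae`, stub `stub_unitaryCohGaloisRep`) obtains the fact
from that statement and (I2) by the one-liners below. -/

/-- **Cor. 1.3 at one `σ'`, from [BLGHT, Thm. 1.2] and the conclusion of Prop. 1.2 at that `σ'`**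
(pointwise form of `corollary13_cuspidalUnitary_of_polarizedProp12`).  For `K` CM presented as
`K/Fp` with involution `cK`, `σ'` cuspidal on Mok's `U_{K/Fp}(2n)`, `p`, `ι`: given
`hB : BLGGT2014_polarized_compatibleSystem_rationalModels` and the conclusion of Prop. 1.2 for
`σ'` in Satake form — constituents `Π_i` regular algebraic cuspidal on `GL_{m_i}(𝔸_K)`,
norm-polarized (`Π_i^c ≅ Π_i^∨ ⊗ ‖det‖^{k_i}`), `Σ m_i d_i = 2n`, and at every finite `u` over a
rational prime above which `K` is unramified and `σ'` is everywhere unramified every base-change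
Satake parameter `β` of `σ'` at `u` is `⊎_i ⊎_{j<d_i} α_i · (√q_u)^{m_i} q_u^j` for Satake
parameters `α_i` of the `Π_i` at `u` — the block sum `⊞_i ⊞_{j<d_i} r_{p,ı}(Π_i) ⊗ ε_p^{-(n+j)}`
is a continuous semisimple `r : Γ_K → GL_{2n}(ℚ̄_p)` unramified at every such `u ∤ p` with
characteristic polynomial of arithmetic Frobenius `arithFrobPolyOfSatake ι q_u (2n) β`
(`exists_galoisRep_of_polarizedConstituents`).  No hypothesis at infinity, at `p` or on `E₀` is
used by this step (they are hypotheses of Prop. 1.2, i.e. of whoever supplies `h12`).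
[cite: HarrisLanTaylorThorneRMS2016, proof of Cor. 1.3 (p. 31)]
[cite: BarnetlambEtAl2014, Thm. 2.1.1] -/
theorem exists_galoisRep_of_polarizedProp12At [IsCMField K]
    (hB : BLGGT2014_polarized_compatibleSystem_rationalModels) (ι : PadicAlgCl p ≃+* ℂ) {n : ℕ}
    {Fp : Type} [Field Fp] [NumberField Fp] [Algebra Fp K] {cK : K ≃ₐ[Fp] K}
    {hcptK : isCompact_glFiniteIntegralLevel (2 * n) K}
    (σ' : UnitaryGroup.CuspidalAutomorphicRepData Fp K cK (2 * n) hcptK)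
    (h12 : ∃ (r : ℕ) (m d : Fin r → ℕ) (_ : ∑ i, m i * d i = 2 * n)
        (hc' : ∀ i, isCompact_glFiniteIntegralLevel (m i) K)
        (πc : ∀ i, CuspidalAutomorphicRepData (m i) K (hc' i)),
        (∀ i, (πc i).1.IsRegularAlgebraic) ∧
        (∀ i, ∃ (χ : HeckeCharacter K) (k : ℤ),
          (∀ x : ideleGroup K, ((χ x : ℂˣ) : ℂ) = (ideleNorm x : ℂ) ^ (k : ℂ)) ∧
            (πc i).1.IsEssConjSelfDual χ) ∧
        ∀ (u : HeightOneSpectrum (𝓞 K)) (β : Multiset ℂ),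
          (∀ u' : HeightOneSpectrum (𝓞 K), u'.asIdeal.under ℤ = u.asIdeal.under ℤ →
            u'.asIdeal.ramificationIdx ℤ = 1 ∧
              UnitaryGroup.IsUnramifiedAt Fp K cK (2 * n) hcptK σ'.1 u') →
          UnitaryGroup.HasBaseChangeSatakeAt Fp K cK (2 * n) hcptK σ'.1 u β →
          ∃ α : Fin r → Multiset ℂ, (∀ i, (πc i).1.HasSatakeParamAt u (α i)) ∧
            β = ∑ i, ∑ j ∈ Finset.range (d i), (α i).map
              (· * ((((Real.sqrt (u.residueCard : ℝ) : ℝ) : ℂ)) ^ (m i) * (u.residueCard : ℂ) ^ j))) :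
    ∃ ρ : FramedGaloisRep K (PadicAlgCl p) (2 * n), ρ.toGaloisRep.IsSemisimple ∧
      ∀ (u : HeightOneSpectrum (𝓞 K)) (β : Multiset ℂ), ((p : ℕ) : 𝓞 K) ∉ u.asIdeal →
        (∀ u' : HeightOneSpectrum (𝓞 K), u'.asIdeal.under ℤ = u.asIdeal.under ℤ →
          u'.asIdeal.ramificationIdx ℤ = 1 ∧
            UnitaryGroup.IsUnramifiedAt Fp K cK (2 * n) hcptK σ'.1 u') →
        UnitaryGroup.HasBaseChangeSatakeAt Fp K cK (2 * n) hcptK σ'.1 u β →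
          ρ.IsUnramifiedAt u ∧
            ρ.HasFrobCharpolyAt u (arithFrobPolyOfSatake ι u.residueCard (2 * n) β) := by
  obtain ⟨r, m, d, hmd, hc', πc, hreg, hpol, hBC⟩ := h12
  obtain ⟨ρ, hρss, hρ⟩ := exists_galoisRep_of_polarizedConstituents (p := p) hB ι hmd πc hreg hpol
    (fun u β => (∀ u' : HeightOneSpectrum (𝓞 K), u'.asIdeal.under ℤ = u.asIdeal.under ℤ →
        u'.asIdeal.ramificationIdx ℤ = 1 ∧
          UnitaryGroup.IsUnramifiedAt Fp K cK (2 * n) hcptK σ'.1 u') ∧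
      UnitaryGroup.HasBaseChangeSatakeAt Fp K cK (2 * n) hcptK σ'.1 u β)
    (fun u β _ hg => hBC u β hg.1 hg.2)
  exact ⟨ρ, hρss, fun u β hu hgood hβ => hρ u β hu ⟨hgood, hβ⟩⟩

/-- **Harris–Lan–Taylor–Thorne 2016, Cor. 1.3 (cuspidal unitary case) from its two printed inputs,
Prop. 1.2 being demanded only in positive rank and under `K ⊇ E₀`.**  As
`corollary13_cuspidalUnitary_of_polarizedProp12`, with the hypothesis `h12` (Prop. 1.2, p. 30,
"`2n = m_1 n_1 + ⋯ + m_r n_r` with `m_i, n_i ∈ ℤ_{>0}` and cuspidal automorphic representations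
`Π̃_i` of `GL_{m_i}(𝔸_F)` such that • `Π̃_i^∨ ≅ Π̃_i^c`; • `Π̃_i ‖det‖^{(m_i+n_i-1)/2}` is
cohomological; • if `v` is a prime of `F` above a rational prime `q` such that either `q` splits in
`F₀`, or `F` and `Π` are unramified above `q`, then
`BC(Π_q)_v = ⊞_{i=1}^r ⊞_{j=0}^{n_i-1} Π̃_{i,v} |det|_v^{(n_i-1)/2-j}`", rendered for cuspidal `σ'`
on Mok's `U_{K/Fp}(2n)` with regular discrete series at the `cK`-fixed complex places, `U → GU`
by Fakhruddin–Pilloni 2021, proof of Thm. 9.11, in Satake form with the regular algebraic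
norm-polarized constituents `Π_i := Π̃_i‖det‖^{(m_i+n_i-1)/2}`, see that theorem's docstring)
restricted to `0 < n` — HLTT's `G_n`, `n ≥ 1` — and keeping the standing hypothesis of [HLTT, §1]
that `K` contains an imaginary quadratic field `E₀` ("Here we are using our assumption that `F`
contains an imaginary quadratic field", proof of Prop. 1.2).  The rank `n = 0` is
`corollary13_cuspidalUnitary_of_pos_rank`; positive rank is `exists_galoisRep_of_polarizedProp12At`
(`K` is CM by `isCMField_of_finrank_eq_two`; the hypothesis "`p` split in `E₀`" is not used).
`h12` is a HYPOTHESIS (D-0026), not a named fact: Shin's base change is not in the tree.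
[cite: HarrisLanTaylorThorneRMS2016, Cor. 1.3 and its proof, Prop. 1.2 (pp. 30–31)]
[cite: BarnetlambEtAl2014, Thm. 2.1.1] -/
theorem corollary13_cuspidalUnitary_of_polarizedProp12_pos
    (hB : BLGGT2014_polarized_compatibleSystem_rationalModels)
    (h12 : ∀ (Fp K : Type) [Field Fp] [NumberField Fp] [Field K] [NumberField K] [IsCMField K]
      [Algebra Fp K] (cK : K ≃ₐ[Fp] K), IsTotallyReal Fp → Module.finrank Fp K = 2 →
      ∀ (hc : cK ≠ 1), IsTotallyComplex K → ∀ (n : ℕ), 0 < n → ∀ (E₀ : IntermediateField ℚ K),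
      Module.finrank ℚ E₀ = 2 ∧ IsTotallyComplex E₀ →
      ∀ (hcptK : isCompact_glFiniteIntegralLevel (2 * n) K)
        (σ' : UnitaryGroup.CuspidalAutomorphicRepData Fp K cK (2 * n) hcptK),
      (∀ (w : {w : InfinitePlace K // w.IsComplex}) (hw : cK • w.1 = w.1),
        ∃ (a b : ℕ) (d : LDSDatum a b), d.IsRegular ∧
          UnitaryGroup.IsNondegenerateLimitOfDiscreteSeriesAt Fp K cK (2 * n)
            (StdForm.antidiagonal (2 * n)) hcptK σ'.1 hw hc d) →
      ∃ (r : ℕ) (m d : Fin r → ℕ) (_ : ∑ i, m i * d i = 2 * n)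
        (hc' : ∀ i, isCompact_glFiniteIntegralLevel (m i) K)
        (πc : ∀ i, CuspidalAutomorphicRepData (m i) K (hc' i)),
        (∀ i, (πc i).1.IsRegularAlgebraic) ∧
        (∀ i, ∃ (χ : HeckeCharacter K) (k : ℤ),
          (∀ x : ideleGroup K, ((χ x : ℂˣ) : ℂ) = (ideleNorm x : ℂ) ^ (k : ℂ)) ∧
            (πc i).1.IsEssConjSelfDual χ) ∧
        ∀ (u : HeightOneSpectrum (𝓞 K)) (β : Multiset ℂ),
          (∀ u' : HeightOneSpectrum (𝓞 K), u'.asIdeal.under ℤ = u.asIdeal.under ℤ →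
            u'.asIdeal.ramificationIdx ℤ = 1 ∧
              UnitaryGroup.IsUnramifiedAt Fp K cK (2 * n) hcptK σ'.1 u') →
          UnitaryGroup.HasBaseChangeSatakeAt Fp K cK (2 * n) hcptK σ'.1 u β →
          ∃ α : Fin r → Multiset ℂ, (∀ i, (πc i).1.HasSatakeParamAt u (α i)) ∧
            β = ∑ i, ∑ j ∈ Finset.range (d i), (α i).map
              (· * ((((Real.sqrt (u.residueCard : ℝ) : ℝ) : ℂ)) ^ (m i) * (u.residueCard : ℂ) ^ j))) :
    HarrisLanTaylorThorne2016_corollary13_cuspidalUnitary := by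
  refine corollary13_cuspidalUnitary_of_pos_rank
    fun Fp K _ _ _ _ _ cK hFp hdeg hc hKc n hn p _ ι E₀ hE₀ _ hcptK σ' hds => ?_
  haveI : IsCMField K := isCMField_of_finrank_eq_two hFp hdeg hKc
  exact exists_galoisRep_of_polarizedProp12At hB ι σ'
    (h12 Fp K cK hFp hdeg hc hKc n hn E₀ hE₀ hcptK σ' hds)

/-! ### The Galois input in Fakhruddin–Pilloni's rendering (appended 2026-08-17)

The printed proof of Cor. 1.3 takes the Galois representations of the regular algebraic,
essentially conjugate self-dual constituents `Π_i` from "for instance, theorem 1.2 of [BLGHT]";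
Fakhruddin–Pilloni (J. Inst. Math. Jussieu 2021 = arXiv:1910.03790, §9.2, p. 44) print the same
compiled theorem as their **Thm. 9.8** ("(Bellaïche, Caraiani, Chenevier, Clozel, Harris, Kottwitz,
Labesse, Shin, Taylor, …). Let `π` be a regular, algebraic, (essentially) conjugate self dual
cuspidal automorphic representation of `GL_n/L`. In particular `π^c = π^∨ ⊗ χ` … There is a
continuous Galois representation `ρ_{π,ι} : G_L → GL_n(ℚ̄_p)` such that: … for all finite place `v`
one has: `WD(ρ_{π,ι}|_{G_{F_v}})^{F-ss} = rec(π_v ⊗ |det|_v^{(1-n)/2})`") and, "in the situation that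
regular is replaced by the weaker assumption of being weakly regular and odd", **Thm. 9.10** (the
unramified compatibility at every `v ∤ p` where `π_v` is unramified), whose regular case is Thm. 9.8
again (proof of Thm. 9.10: "the Hecke eigensystem of `π̃` is a `p`-adic limit of Hecke eigensystems
of regular, essentially conjugate self dual, automorphic representations to which Theorem 9.8
applies").  In the tree Thm. 9.10 with Thm. 9.1 at the norm characters `χ = ‖·‖_𝔸^m` is the
EXISTING named fact `FakhruddinPilloni2021_galoisRep_of_weaklyRegular_normTwist`
(`WeaklyRegularGaloisRep.lean`), and its regular slice is the proved
`FakhruddinPilloni2021_galoisRep_of_regularAlgebraic_normTwist` (regular ⇒ weakly regular and, in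
positive rank, not evenly paired).  That rendering carries no semisimplicity clause; the conclusion
of Cor. 1.3 asks for a SEMISIMPLE `r`, which is supplied — exactly as in "replacing `ρ` by its
semisimplification" (Deligne–Serre 1974, 6.12; Taylor 1991, §1) — by the every-rank
semisimplification of framed Galois representations `FramedGaloisRep.exists_semisimplification`
(`FramedGaloisRepSemisimplification.lean`, 2026-08-17: same characteristic polynomials, unramified
wherever the original is, every Frobenius characteristic polynomial kept).  So the combination
step, and the named fact from Prop. 1.2, hold equally with the Galois input `hFP` in place of `hB`:
a second existing, non-circular rendering of input (I2) (neither Thm. 9.8 nor Thm. 9.10 is deduced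
from [HLTT] in print).  No new definition, no new named fact; `h12` keeps VERBATIM the type it has
in `corollary13_cuspidalUnitary_of_polarizedProp12_pos`, so one vendored statement of Prop. 1.2
serves both. -/

/-- **Rank `0`: the trivial homomorphism `Γ_K → GL_0(ℚ̄_p)`** is semisimple (its space has a single
subrepresentation), unramified everywhere, and has at every finite place the predicted polynomial
of an empty Satake parameter, `arithFrobPolyOfSatake ι q_v 0 0 = 1 = det (X - ·)` on `0 × 0`
matrices (`HasSatakeParamAt.card_eq`: a Satake parameter in rank `0` is empty).  The degenerate
constituent rank, where Fakhruddin–Pilloni's hypotheses ("not evenly paired") cannot hold. [folklore] -/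
theorem exists_galoisRep_rank_zero (ι : PadicAlgCl p ≃+* ℂ)
    {hc : isCompact_glFiniteIntegralLevel 0 K} (π : CuspidalAutomorphicRepData 0 K hc) :
    ∃ ρ : FramedGaloisRep K (PadicAlgCl p) 0, ρ.toGaloisRep.IsSemisimple ∧
      ∀ (v : HeightOneSpectrum (𝓞 K)) (α : Multiset ℂ), π.1.HasSatakeParamAt v α →
        ((p : ℕ) : 𝓞 K) ∉ v.asIdeal →
          ρ.IsUnramifiedAt v ∧ ρ.HasFrobCharpolyAt v (arithFrobPolyOfSatake ι v.residueCard 0 α) := by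
  refine ⟨1, ?_, fun v α hα _ => ?_⟩
  · haveI : Subsingleton (Subrepresentation
        ((1 : FramedGaloisRep K (PadicAlgCl p) 0).toGaloisRep.toRepresentation)) :=
      ⟨fun a b ↦ Subrepresentation.toSubmodule_injective (Subsingleton.elim _ _)⟩
    exact Subsingleton.instComplementedLattice
  · have hα0 : α = 0 := Multiset.card_eq_zero.mp hα.card_eq
    subst hα0
    refine ⟨fun 𝔓 _ τ _ ↦ by simp, fun 𝔓 _ τ _ ↦ ?_⟩
    simp [FramedRep.charpoly, arithFrobPolyOfSatake, Matrix.charpoly, Matrix.det_isEmpty]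

/-- **The Galois representation of ONE regular algebraic norm-polarized cuspidal `π` on
`GL_n(𝔸_K)`, `K` CM, in Fakhruddin–Pilloni's rendering, made semisimple.**  From
`hFP : FakhruddinPilloni2021_galoisRep_of_weaklyRegular_normTwist` (Thm. 9.10 with Thm. 9.1; in the
regular case the content of Thm. 9.8 = [BLGHT, Thm. 1.2]): for `π` regular algebraic cuspidal with
`π^c ≅ π^∨ ⊗ (χ ∘ det)`, `χ = ‖·‖_𝔸^k`, every `p` and `ι`, a continuous SEMISIMPLE
`ρ : Γ_K → GL_n(ℚ̄_p)` unramified with arithmetic-Frobenius polynomial `arithFrobPolyOfSatake ι q_v n α`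
at every `v ∤ p` where `π` has Satake parameter `α` — in positive rank the regular slice
`FakhruddinPilloni2021_galoisRep_of_regularAlgebraic_normTwist` followed by the semisimplification
`FramedGaloisRep.exists_semisimplification` (Deligne–Serre 1974, 6.12), in rank `0` the trivial
homomorphism (`exists_galoisRep_rank_zero`).
[cite: FakhruddinPilloni2021, Thm. 9.10 with Thm. 9.1, and Thm. 9.8 (§9.2, p. 44)] -/
theorem exists_galoisRep_semisimple_of_normTwist [IsCMField K]
    (hFP : FakhruddinPilloni2021_galoisRep_of_weaklyRegular_normTwist) (ι : PadicAlgCl p ≃+* ℂ)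
    {n : ℕ} {hc : isCompact_glFiniteIntegralLevel n K} (π : CuspidalAutomorphicRepData n K hc)
    (hπ : π.1.IsRegularAlgebraic)
    (hpol : ∃ (χ : HeckeCharacter K) (k : ℤ),
      (∀ x : ideleGroup K, ((χ x : ℂˣ) : ℂ) = (ideleNorm x : ℂ) ^ (k : ℂ)) ∧ π.1.IsEssConjSelfDual χ) :
    ∃ ρ : FramedGaloisRep K (PadicAlgCl p) n, ρ.toGaloisRep.IsSemisimple ∧
      ∀ (v : HeightOneSpectrum (𝓞 K)) (α : Multiset ℂ), π.1.HasSatakeParamAt v α →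
        ((p : ℕ) : 𝓞 K) ∉ v.asIdeal →
          ρ.IsUnramifiedAt v ∧ ρ.HasFrobCharpolyAt v (arithFrobPolyOfSatake ι v.residueCard n α) := by
  rcases Nat.eq_zero_or_pos n with rfl | hn
  · exact exists_galoisRep_rank_zero ι π
  · obtain ⟨χ, k, hχ, hsd⟩ := hpol
    obtain ⟨ρ₀, hρ₀⟩ :=
      FakhruddinPilloni2021_galoisRep_of_regularAlgebraic_normTwist hFP hn π hπ hχ hsd p ι
    obtain ⟨ρ, hss, -, -, hunr, hfrob⟩ := ρ₀.exists_semisimplification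
    exact ⟨ρ, hss, fun v α hα hv =>
      ⟨hunr v (hρ₀ v α hα hv).1, hfrob v _ (hρ₀ v α hα hv).2⟩⟩

/-- **The Galois representation of an isobaric datum with regular algebraic NORM-POLARIZED
constituents, Galois input in Fakhruddin–Pilloni's rendering** — the statement of
`exists_galoisRep_of_polarizedConstituents` with
`hFP : FakhruddinPilloni2021_galoisRep_of_weaklyRegular_normTwist` (Thm. 9.10 with Thm. 9.1; in the
regular case Thm. 9.8 = "theorem 1.2 of [BLGHT]", the printed input of Cor. 1.3) in place of
`hB : BLGGT2014_polarized_compatibleSystem_rationalModels`: `K` CM, `Π_i` regular algebraic cuspidal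
on `GL_{m_i}(𝔸_K)` with `Π_i^c ≅ Π_i^∨ ⊗ (χ_i ∘ det)`, `χ_i = ‖·‖_𝔸^{k_i}`, `Σ m_i d_i = 2n`, and
`hBC` as in `exists_galoisRep_of_constituents` ⇒ a continuous semisimple
`ρ = ⊞_i ⊞_{j<d_i} ρ_i ⊗ ε_p^{-(n+j)} : Γ_K → GL_{2n}(ℚ̄_p)` with the conclusion of Cor. 1.3 at the
good places, the `ρ_i` being the semisimplified representations of
`exists_galoisRep_semisimple_of_normTwist`.  A corollary of `exists_galoisRep_of_constituents`.
[cite: HarrisLanTaylorThorneRMS2016, proof of Cor. 1.3 (p. 31)]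
[cite: FakhruddinPilloni2021, Thm. 9.8 and Thm. 9.10 (§9.2, p. 44)] -/
theorem exists_galoisRep_of_normTwistConstituents [IsCMField K]
    (hFP : FakhruddinPilloni2021_galoisRep_of_weaklyRegular_normTwist) (ι : PadicAlgCl p ≃+* ℂ)
    {n r : ℕ} {m d : Fin r → ℕ} (hmd : ∑ i, m i * d i = 2 * n)
    {hc : ∀ i, isCompact_glFiniteIntegralLevel (m i) K}
    (πc : ∀ i, CuspidalAutomorphicRepData (m i) K (hc i)) (hπc : ∀ i, (πc i).1.IsRegularAlgebraic)
    (hpol : ∀ i, ∃ (χ : HeckeCharacter K) (k : ℤ),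
      (∀ x : ideleGroup K, ((χ x : ℂˣ) : ℂ) = (ideleNorm x : ℂ) ^ (k : ℂ)) ∧
        (πc i).1.IsEssConjSelfDual χ)
    (Good : HeightOneSpectrum (𝓞 K) → Multiset ℂ → Prop)
    (hBC : ∀ (u : HeightOneSpectrum (𝓞 K)) (β : Multiset ℂ), ((p : ℕ) : 𝓞 K) ∉ u.asIdeal →
      Good u β → ∃ α : Fin r → Multiset ℂ, (∀ i, (πc i).1.HasSatakeParamAt u (α i)) ∧
        β = ∑ i, ∑ j ∈ Finset.range (d i), (α i).map
          (· * ((((Real.sqrt (u.residueCard : ℝ) : ℝ) : ℂ)) ^ (m i) * (u.residueCard : ℂ) ^ j))) :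
    ∃ ρ : FramedGaloisRep K (PadicAlgCl p) (2 * n), ρ.toGaloisRep.IsSemisimple ∧
      ∀ (u : HeightOneSpectrum (𝓞 K)) (β : Multiset ℂ), ((p : ℕ) : 𝓞 K) ∉ u.asIdeal → Good u β →
        ρ.IsUnramifiedAt u ∧ ρ.HasFrobCharpolyAt u (arithFrobPolyOfSatake ι u.residueCard (2 * n) β) :=
  exists_galoisRep_of_constituents ι hmd πc
    (fun i => exists_galoisRep_semisimple_of_normTwist hFP ι (πc i) (hπc i) (hpol i)) Good hBC

/-- **Cor. 1.3 at one `σ'`, from Fakhruddin–Pilloni's Thm. 9.10/9.8 and the conclusion of Prop. 1.2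
at that `σ'`** — the statement of `exists_galoisRep_of_polarizedProp12At` with the Galois input
`hFP : FakhruddinPilloni2021_galoisRep_of_weaklyRegular_normTwist` in place of `hB`; `h12` (the
conclusion of Prop. 1.2 for `σ'` in Satake form, regular algebraic norm-polarized constituents) has
VERBATIM the type it has there.  From `exists_galoisRep_of_normTwistConstituents`.
[cite: HarrisLanTaylorThorneRMS2016, proof of Cor. 1.3 (p. 31)]
[cite: FakhruddinPilloni2021, Thm. 9.8 and Thm. 9.10 (§9.2, p. 44)] -/
theorem exists_galoisRep_of_normTwistProp12At [IsCMField K]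
    (hFP : FakhruddinPilloni2021_galoisRep_of_weaklyRegular_normTwist) (ι : PadicAlgCl p ≃+* ℂ)
    {n : ℕ} {Fp : Type} [Field Fp] [NumberField Fp] [Algebra Fp K] {cK : K ≃ₐ[Fp] K}
    {hcptK : isCompact_glFiniteIntegralLevel (2 * n) K}
    (σ' : UnitaryGroup.CuspidalAutomorphicRepData Fp K cK (2 * n) hcptK)
    (h12 : ∃ (r : ℕ) (m d : Fin r → ℕ) (_ : ∑ i, m i * d i = 2 * n)
        (hc' : ∀ i, isCompact_glFiniteIntegralLevel (m i) K)
        (πc : ∀ i, CuspidalAutomorphicRepData (m i) K (hc' i)),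
        (∀ i, (πc i).1.IsRegularAlgebraic) ∧
        (∀ i, ∃ (χ : HeckeCharacter K) (k : ℤ),
          (∀ x : ideleGroup K, ((χ x : ℂˣ) : ℂ) = (ideleNorm x : ℂ) ^ (k : ℂ)) ∧
            (πc i).1.IsEssConjSelfDual χ) ∧
        ∀ (u : HeightOneSpectrum (𝓞 K)) (β : Multiset ℂ),
          (∀ u' : HeightOneSpectrum (𝓞 K), u'.asIdeal.under ℤ = u.asIdeal.under ℤ →
            u'.asIdeal.ramificationIdx ℤ = 1 ∧
              UnitaryGroup.IsUnramifiedAt Fp K cK (2 * n) hcptK σ'.1 u') →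
          UnitaryGroup.HasBaseChangeSatakeAt Fp K cK (2 * n) hcptK σ'.1 u β →
          ∃ α : Fin r → Multiset ℂ, (∀ i, (πc i).1.HasSatakeParamAt u (α i)) ∧
            β = ∑ i, ∑ j ∈ Finset.range (d i), (α i).map
              (· * ((((Real.sqrt (u.residueCard : ℝ) : ℝ) : ℂ)) ^ (m i) * (u.residueCard : ℂ) ^ j))) :
    ∃ ρ : FramedGaloisRep K (PadicAlgCl p) (2 * n), ρ.toGaloisRep.IsSemisimple ∧
      ∀ (u : HeightOneSpectrum (𝓞 K)) (β : Multiset ℂ), ((p : ℕ) : 𝓞 K) ∉ u.asIdeal →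
        (∀ u' : HeightOneSpectrum (𝓞 K), u'.asIdeal.under ℤ = u.asIdeal.under ℤ →
          u'.asIdeal.ramificationIdx ℤ = 1 ∧
            UnitaryGroup.IsUnramifiedAt Fp K cK (2 * n) hcptK σ'.1 u') →
        UnitaryGroup.HasBaseChangeSatakeAt Fp K cK (2 * n) hcptK σ'.1 u β →
          ρ.IsUnramifiedAt u ∧
            ρ.HasFrobCharpolyAt u (arithFrobPolyOfSatake ι u.residueCard (2 * n) β) := by
  obtain ⟨r, m, d, hmd, hc', πc, hreg, hpol, hBC⟩ := h12
  obtain ⟨ρ, hρss, hρ⟩ := exists_galoisRep_of_normTwistConstituents (p := p) hFP ι hmd πc hreg hpol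
    (fun u β => (∀ u' : HeightOneSpectrum (𝓞 K), u'.asIdeal.under ℤ = u.asIdeal.under ℤ →
        u'.asIdeal.ramificationIdx ℤ = 1 ∧
          UnitaryGroup.IsUnramifiedAt Fp K cK (2 * n) hcptK σ'.1 u') ∧
      UnitaryGroup.HasBaseChangeSatakeAt Fp K cK (2 * n) hcptK σ'.1 u β)
    (fun u β _ hg => hBC u β hg.1 hg.2)
  exact ⟨ρ, hρss, fun u β hu hgood hβ => hρ u β hu ⟨hgood, hβ⟩⟩

/-- **Harris–Lan–Taylor–Thorne 2016, Cor. 1.3 (cuspidal unitary case) from Prop. 1.2 and the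
Galois input in Fakhruddin–Pilloni's rendering** — the statement of
`corollary13_cuspidalUnitary_of_polarizedProp12_pos` with
`hFP : FakhruddinPilloni2021_galoisRep_of_weaklyRegular_normTwist` (Fakhruddin–Pilloni 2021,
Thm. 9.10 with Thm. 9.1; in the regular case used here, Thm. 9.8 = "for instance, theorem 1.2 of
[BLGHT]", the printed Galois input of Cor. 1.3, p. 31) in place of
`hB : BLGGT2014_polarized_compatibleSystem_rationalModels`, and with `h12` — Prop. 1.2 (Shin's
cohomological base change with Mœglin–Waldspurger, pp. 30–31) in Satake form for cuspidal `σ'` on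
Mok's `U_{K/Fp}(2n)` with regular discrete series at the `cK`-fixed complex places, demanded only
for `0 < n` and under `K ⊇ E₀` imaginary quadratic, see the docstring of
`corollary13_cuspidalUnitary_of_polarizedProp12_pos` — of VERBATIM the same type as there (a
HYPOTHESIS, D-0026: Shin's base change is not a declaration of the tree).  Rank `0` is
`corollary13_cuspidalUnitary_of_pos_rank`; positive rank is `exists_galoisRep_of_normTwistProp12At`
(`K` is CM by `isCMField_of_finrank_eq_two`; "`p` split in `E₀`" is not used by this step).  With
this theorem the named fact is proved in the tree modulo Prop. 1.2 and EITHER of the two existing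
renderings of its Galois input, `BLGGT2014_polarized_compatibleSystem_rationalModels` or
`FakhruddinPilloni2021_galoisRep_of_weaklyRegular_normTwist`.
[cite: HarrisLanTaylorThorneRMS2016, Cor. 1.3 and its proof, Prop. 1.2 (pp. 30–31)]
[cite: FakhruddinPilloni2021, Thm. 9.8 and Thm. 9.10 with Thm. 9.1 (§9.2, p. 44)] -/
theorem corollary13_cuspidalUnitary_of_normTwistProp12_pos
    (hFP : FakhruddinPilloni2021_galoisRep_of_weaklyRegular_normTwist)
    (h12 : ∀ (Fp K : Type) [Field Fp] [NumberField Fp] [Field K] [NumberField K] [IsCMField K]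
      [Algebra Fp K] (cK : K ≃ₐ[Fp] K), IsTotallyReal Fp → Module.finrank Fp K = 2 →
      ∀ (hc : cK ≠ 1), IsTotallyComplex K → ∀ (n : ℕ), 0 < n → ∀ (E₀ : IntermediateField ℚ K),
      Module.finrank ℚ E₀ = 2 ∧ IsTotallyComplex E₀ →
      ∀ (hcptK : isCompact_glFiniteIntegralLevel (2 * n) K)
        (σ' : UnitaryGroup.CuspidalAutomorphicRepData Fp K cK (2 * n) hcptK),
      (∀ (w : {w : InfinitePlace K // w.IsComplex}) (hw : cK • w.1 = w.1),
        ∃ (a b : ℕ) (d : LDSDatum a b), d.IsRegular ∧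
          UnitaryGroup.IsNondegenerateLimitOfDiscreteSeriesAt Fp K cK (2 * n)
            (StdForm.antidiagonal (2 * n)) hcptK σ'.1 hw hc d) →
      ∃ (r : ℕ) (m d : Fin r → ℕ) (_ : ∑ i, m i * d i = 2 * n)
        (hc' : ∀ i, isCompact_glFiniteIntegralLevel (m i) K)
        (πc : ∀ i, CuspidalAutomorphicRepData (m i) K (hc' i)),
        (∀ i, (πc i).1.IsRegularAlgebraic) ∧
        (∀ i, ∃ (χ : HeckeCharacter K) (k : ℤ),
          (∀ x : ideleGroup K, ((χ x : ℂˣ) : ℂ) = (ideleNorm x : ℂ) ^ (k : ℂ)) ∧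
            (πc i).1.IsEssConjSelfDual χ) ∧
        ∀ (u : HeightOneSpectrum (𝓞 K)) (β : Multiset ℂ),
          (∀ u' : HeightOneSpectrum (𝓞 K), u'.asIdeal.under ℤ = u.asIdeal.under ℤ →
            u'.asIdeal.ramificationIdx ℤ = 1 ∧
              UnitaryGroup.IsUnramifiedAt Fp K cK (2 * n) hcptK σ'.1 u') →
          UnitaryGroup.HasBaseChangeSatakeAt Fp K cK (2 * n) hcptK σ'.1 u β →
          ∃ α : Fin r → Multiset ℂ, (∀ i, (πc i).1.HasSatakeParamAt u (α i)) ∧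
            β = ∑ i, ∑ j ∈ Finset.range (d i), (α i).map
              (· * ((((Real.sqrt (u.residueCard : ℝ) : ℝ) : ℂ)) ^ (m i) * (u.residueCard : ℂ) ^ j))) :
    HarrisLanTaylorThorne2016_corollary13_cuspidalUnitary := by
  refine corollary13_cuspidalUnitary_of_pos_rank
    fun Fp K _ _ _ _ _ cK hFp hdeg hc hKc n hn p _ ι E₀ hE₀ _ hcptK σ' hds => ?_
  haveI : IsCMField K := isCMField_of_finrank_eq_two hFp hdeg hKc
  exact exists_galoisRep_of_normTwistProp12At hFP ι σ'
    (h12 Fp K cK hFp hdeg hc hKc n hn E₀ hE₀ hcptK σ' hds)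

end Corollary13

end HarrisLanTaylorThorne2016

end Literature.NumberTheory.Automorphic
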